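import Mathlib.Analysis.SpecialFunctions.Pow.Real
import Mathlib.Analysis.SpecificLimits.Basic
import HarnessLib

/-!
# A dyadic bootstrap lemma (the iteration behind Bamler 2020a, Thm. 7.1)

R. Bamler, *Entropy and heat kernel bounds on a Ricci flow background*, arXiv:2008.07093 (2020a),
§7.2, proof of Thm. 7.1: the heat kernel bound `u ≤ Z t^{-n/2} exp(−𝒩*)` is improved from `Z` to
`Z/2` as long as `Z ≥ Z̲`, "so by induction" the bound holds with a universal `Z`; the induction is
anchored by an a-priori bound "which may depend on the underlying Ricci flow". Run at a fixed scale
(no parabolic rescaling), the induction becomes the following elementary real-variable statement,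
which is all that is used downstream: if a function `G` on `(0, τ₀]` satisfies the two-point
recursion `G(τ) ≤ C + θ₁ G(λτ) + θ₂ G(τ/2)` (`1/2 ≤ λ ≤ 1`, `θᵢ ≥ 0`) and the a-priori polynomial
bound `G(τ) ≤ A τ^{-p}`, and the recursion contracts faster than the a-priori bound can grow along
dyadic scales, `(θ₁ + θ₂) 2^p < 1`, then `G ≤ C / (1 − θ₁ − θ₂)` on `(0, τ₀]`.

* `dyadicBootstrap_le_depth` — the finite-depth bound
  `G(τ) ≤ C(1 − θ^k)/(1 − θ) + θ^k 2^{kp} A τ^{-p}` (induction on the depth `k`);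
* `dyadicBootstrap_le` — the statement above (`k → ∞`).

Elementary; [folklore] (the bookkeeping of Bamler's "by induction" at a fixed scale). Nothing about
Ricci flow is in this file.
-/

noncomputable section

open Set Filter
open scoped Topology

namespace Literature.Analysis.Calculus

/-- `(λ τ)^{-p} ≤ 2^p τ^{-p}` for `λ ≥ 1/2`, `τ > 0`, `p ≥ 0`. [folklore] -/
theorem mul_rpow_neg_le_two_rpow_mul {lam τ p : ℝ} (hlam : 1 / 2 ≤ lam) (hτ : 0 < τ) (hp : 0 ≤ p) :
    (lam * τ) ^ (-p) ≤ (2 : ℝ) ^ p * τ ^ (-p) := by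
  have hlam0 : 0 < lam := lt_of_lt_of_le (by norm_num) hlam
  rw [Real.mul_rpow hlam0.le hτ.le]
  refine mul_le_mul_of_nonneg_right ?_ (Real.rpow_nonneg hτ.le _)
  calc lam ^ (-p) ≤ (1 / 2 : ℝ) ^ (-p) :=
        Real.rpow_le_rpow_of_nonpos (by norm_num) hlam (by linarith)
    _ = (2 : ℝ) ^ p := by
        rw [one_div, Real.inv_rpow (by norm_num : (0 : ℝ) ≤ 2), Real.rpow_neg (by norm_num),
          inv_inv]

/-- `(τ/2)^{-p} = 2^p τ^{-p}` for `τ > 0`. [folklore] -/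
theorem div_two_rpow_neg {τ p : ℝ} (hτ : 0 < τ) :
    (τ / 2) ^ (-p) = (2 : ℝ) ^ p * τ ^ (-p) := by
  rw [div_eq_mul_inv, Real.mul_rpow hτ.le (by norm_num), Real.inv_rpow (by norm_num : (0 : ℝ) ≤ 2),
    Real.rpow_neg (by norm_num : (0 : ℝ) ≤ 2), inv_inv, mul_comm]

/-- The finite-depth form of the bootstrap: under the two-point recursion
`G τ ≤ C + θ₁ G(λτ) + θ₂ G(τ/2)` on `(0, τ₀]` (`1/2 ≤ λ ≤ 1`, `θᵢ ≥ 0`, `θ₁ + θ₂ < 1`) and the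
a-priori bound `G τ ≤ A τ^{-p}` (`A, p ≥ 0`), for every depth `k` and `τ ∈ (0, τ₀]`,
`G τ ≤ C (1 − θ^k)/(1 − θ) + θ^k 2^{kp} A τ^{-p}` with `θ = θ₁ + θ₂`. [folklore] -/
theorem dyadicBootstrap_le_depth {G : ℝ → ℝ} {τ₀ C θ₁ θ₂ lam A p : ℝ}
    (hθ₁ : 0 ≤ θ₁) (hθ₂ : 0 ≤ θ₂) (hθ : θ₁ + θ₂ < 1) (hlam : 1 / 2 ≤ lam) (hlam1 : lam ≤ 1)
    (hA : 0 ≤ A) (hp : 0 ≤ p)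
    (hapriori : ∀ τ ∈ Ioc 0 τ₀, G τ ≤ A * τ ^ (-p))
    (hrec : ∀ τ ∈ Ioc 0 τ₀, G τ ≤ C + θ₁ * G (lam * τ) + θ₂ * G (τ / 2)) (k : ℕ) :
    ∀ τ ∈ Ioc 0 τ₀, G τ ≤ C * (1 - (θ₁ + θ₂) ^ k) / (1 - (θ₁ + θ₂)) +
      (θ₁ + θ₂) ^ k * (2 : ℝ) ^ ((k : ℝ) * p) * A * τ ^ (-p) := by
  have hθ0 : 0 ≤ θ₁ + θ₂ := add_nonneg hθ₁ hθ₂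
  have h1θ : 0 < 1 - (θ₁ + θ₂) := sub_pos.2 hθ
  induction k with
  | zero =>
    intro τ hτ
    simpa using hapriori τ hτ
  | succ k ih =>
    intro τ hτ
    have hτ0 : 0 < τ := hτ.1
    have hlam0 : 0 < lam := lt_of_lt_of_le (by norm_num) hlam
    -- the two children of `τ` in the recursion tree lie in `(0, τ₀]`
    have hτ₁ : lam * τ ∈ Ioc 0 τ₀ :=
      ⟨mul_pos hlam0 hτ0, (mul_le_of_le_one_left hτ0.le hlam1).trans hτ.2⟩
    have hτ₂ : τ / 2 ∈ Ioc 0 τ₀ := ⟨by positivity, (half_le_self hτ0.le).trans hτ.2⟩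
    have ih₁ := ih (lam * τ) hτ₁
    have ih₂ := ih (τ / 2) hτ₂
    -- abbreviations
    set θ := θ₁ + θ₂ with hθdef
    set Ck : ℝ := C * (1 - θ ^ k) / (1 - θ) with hCk
    set Bk : ℝ := θ ^ k * (2 : ℝ) ^ ((k : ℝ) * p) * A with hBk
    have hBk0 : 0 ≤ Bk := by positivity
    have hτp : 0 ≤ τ ^ (-p) := Real.rpow_nonneg hτ0.le _
    -- children bounds in terms of `2^p τ^{-p}`
    have hc₁ : G (lam * τ) ≤ Ck + Bk * ((2 : ℝ) ^ p * τ ^ (-p)) := by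
      have := mul_rpow_neg_le_two_rpow_mul hlam hτ0 hp
      calc G (lam * τ) ≤ Ck + Bk * (lam * τ) ^ (-p) := by rw [hCk, hBk]; linarith [ih₁]
        _ ≤ Ck + Bk * ((2 : ℝ) ^ p * τ ^ (-p)) := by gcongr
    have hc₂ : G (τ / 2) ≤ Ck + Bk * ((2 : ℝ) ^ p * τ ^ (-p)) := by
      have := div_two_rpow_neg (p := p) hτ0
      calc G (τ / 2) ≤ Ck + Bk * (τ / 2) ^ (-p) := by rw [hCk, hBk]; linarith [ih₂]
        _ = Ck + Bk * ((2 : ℝ) ^ p * τ ^ (-p)) := by rw [this]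
    -- combine through the recursion
    have hstep : G τ ≤ C + θ * Ck + θ * Bk * ((2 : ℝ) ^ p * τ ^ (-p)) := by
      have e₁ := mul_le_mul_of_nonneg_left hc₁ hθ₁
      have e₂ := mul_le_mul_of_nonneg_left hc₂ hθ₂
      have := hrec τ hτ
      rw [hθdef]
      nlinarith [e₁, e₂, this]
    -- identify the constants at depth `k + 1`
    have hpow : (2 : ℝ) ^ (((k + 1 : ℕ) : ℝ) * p) = (2 : ℝ) ^ p * (2 : ℝ) ^ ((k : ℝ) * p) := by
      rw [← Real.rpow_add two_pos, Nat.cast_succ]; ring_nf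
    have hCsucc : C + θ * Ck = C * (1 - θ ^ (k + 1)) / (1 - θ) := by
      rw [hCk]; field_simp; ring
    have hBsucc : θ * Bk * ((2 : ℝ) ^ p * τ ^ (-p)) =
        θ ^ (k + 1) * (2 : ℝ) ^ (((k + 1 : ℕ) : ℝ) * p) * A * τ ^ (-p) := by
      rw [hBk, hpow]; ring
    calc G τ ≤ C + θ * Ck + θ * Bk * ((2 : ℝ) ^ p * τ ^ (-p)) := hstep
      _ = C * (1 - θ ^ (k + 1)) / (1 - θ) +
          θ ^ (k + 1) * (2 : ℝ) ^ (((k + 1 : ℕ) : ℝ) * p) * A * τ ^ (-p) := by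
        rw [← hCsucc, hBsucc]

/-- **Dyadic bootstrap.** Let `G : ℝ → ℝ` satisfy on `(0, τ₀]` the two-point recursion
`G τ ≤ C + θ₁ G(λτ) + θ₂ G(τ/2)` (`1/2 ≤ λ ≤ 1`, `θ₁, θ₂ ≥ 0`) and the a-priori bound
`G τ ≤ A τ^{-p}` (`A, p ≥ 0`). If `(θ₁ + θ₂) 2^p < 1`, then `G τ ≤ C / (1 − θ₁ − θ₂)` on
`(0, τ₀]` — the fixed-scale form of the induction in Bamler 2020a, §7.2 (proof of Thm. 7.1: "it is
enough to show that if the bound holds for some `Z`, then it also holds for `Z` replaced with `Z/2`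
if `Z ≥ Z̲` … such a bound holds for some large `Z`, which may depend on the underlying flow").
[folklore] -/
theorem dyadicBootstrap_le {G : ℝ → ℝ} {τ₀ C θ₁ θ₂ lam A p : ℝ} (hC : 0 ≤ C)
    (hθ₁ : 0 ≤ θ₁) (hθ₂ : 0 ≤ θ₂) (hlam : 1 / 2 ≤ lam) (hlam1 : lam ≤ 1)
    (hA : 0 ≤ A) (hp : 0 ≤ p) (hcontr : (θ₁ + θ₂) * (2 : ℝ) ^ p < 1)
    (hapriori : ∀ τ ∈ Ioc 0 τ₀, G τ ≤ A * τ ^ (-p))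
    (hrec : ∀ τ ∈ Ioc 0 τ₀, G τ ≤ C + θ₁ * G (lam * τ) + θ₂ * G (τ / 2)) :
    ∀ τ ∈ Ioc 0 τ₀, G τ ≤ C / (1 - (θ₁ + θ₂)) := by
  intro τ hτ
  set θ := θ₁ + θ₂ with hθdef
  have hθ0 : 0 ≤ θ := add_nonneg hθ₁ hθ₂
  have h2p : (1 : ℝ) ≤ (2 : ℝ) ^ p := Real.one_le_rpow (by norm_num) hp
  have hθ : θ < 1 := by nlinarith
  have h1θ : 0 < 1 - θ := sub_pos.2 hθ
  -- `q := θ 2^p ∈ [0, 1)`, and `θ^k 2^{kp} = q^k`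
  set q : ℝ := θ * (2 : ℝ) ^ p with hq
  have hq0 : 0 ≤ q := by positivity
  have hqk : ∀ k : ℕ, θ ^ k * (2 : ℝ) ^ ((k : ℝ) * p) = q ^ k := fun k ↦ by
    rw [hq, mul_pow, mul_comm (k : ℝ) p, Real.rpow_mul_natCast (by norm_num : (0 : ℝ) ≤ 2)]
  -- the finite-depth bounds
  have hdepth : ∀ k : ℕ, G τ ≤ C / (1 - θ) + q ^ k * (A * τ ^ (-p)) := fun k ↦ by
    have hk := dyadicBootstrap_le_depth hθ₁ hθ₂ hθ hlam hlam1 hA hp hapriori hrec k τ hτ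
    rw [← hθdef] at hk
    have hmono : C * (1 - θ ^ k) / (1 - θ) ≤ C / (1 - θ) := by
      rw [div_le_div_iff_of_pos_right h1θ]
      nlinarith [pow_nonneg hθ0 k]
    calc G τ ≤ C * (1 - θ ^ k) / (1 - θ) + θ ^ k * (2 : ℝ) ^ ((k : ℝ) * p) * A * τ ^ (-p) := hk
      _ = C * (1 - θ ^ k) / (1 - θ) + q ^ k * (A * τ ^ (-p)) := by rw [← hqk k]; ring
      _ ≤ C / (1 - θ) + q ^ k * (A * τ ^ (-p)) := by gcongr
  -- let `k → ∞`
  have hlim : Tendsto (fun k : ℕ ↦ C / (1 - θ) + q ^ k * (A * τ ^ (-p))) atTop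
      (𝓝 (C / (1 - θ) + 0 * (A * τ ^ (-p)))) :=
    tendsto_const_nhds.add ((tendsto_pow_atTop_nhds_zero_of_lt_one hq0 hcontr).mul_const _)
  rw [zero_mul, add_zero] at hlim
  exact ge_of_tendsto' hlim hdepth

end Literature.Analysis.Calculus

end
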